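import Literature.NumberTheory.ComplexMultiplication.DegenerateCMTypesCompositeDimension
import HarnessLib

/-!
# Dodson's converse of Ribet's theorem, group level II: the rank `n − l + 2` and the primitivity of the block type
# (Dodson 1984, §3.2.1)

Sequel of `DegenerateCMTypesCompositeDimension.lean` (same setting and hypotheses: a finite commutative group
`G = ⟨ρ⟩ × ⟨σ⟩`, `ρ` an involution `≠ 1`, `σ` of order `n`, `ρ ∉ ⟨σ⟩`, `|G| = 2n`; Dodson's block type `Φ = Φᶠ`,
`f = (1_l, 0, …, 0)`, characterised by `σⁱ ∈ Φ ↔ l ≤ i mod n`, `ρσⁱ ∈ Φ ↔ i mod n < l`), B. Dodson, *The structure of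
Galois groups of CM-fields*, Trans. AMS 283 (1984) [Dodson1984], §3.2.1 "THEOREM (A Converse of Ribet's Theorem [15]).
Let `n > 4` be composite and factor `n` as `n = kl`, with `k ≥ 3`, `l ≥ 2`.  Then there exist simple degenerate
Abelian varieties of dimension `n` and rank `n − l + 2`", proof: "`r = (k − 1)l + 1` in the constant weight
criterion, so `rank(K, Φᶠ) = n − l + 2` […]. Finally, note that `Φ` is primitive since the orbit of `f` under `G` has
order `2n`" (held text `paper:doi-10-2307-1999987`, p. 13).  PROVED here:

* `typeRank_blockType` — **`rank(Φᶠ) = n − l + 2`** (`l ∣ n`, `0 < l`, `2l ≠ n`; Kubota's formula with the count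
  `l − 1` of vanishing odd characters of part I), `typeRank_blockType_lt` — DEGENERATE for `l ≥ 2`;
* `eq_of_forall_mul_mem_iff_blockType` — for `0 < l`, `2l < n` (i.e. `k ≥ 3`) the translates of `Φᶠ` separate the
  points of `G`: the type is PRIMITIVE in the separation form of the tree's `isPrimitive_iff_forall_eq`
  (`CMTypeRank.lean`); via `pow_eq_one_of_forall_mem_iff_mul_pow` (no power `σᵐ ≠ 1` stabilises `Φᶠ`) and
  `not_forall_mem_iff_mul_rho_mul_pow` (no `ρσʲ` does);
* `exists_primitive_degenerate_blockType` — §3.2.1 packaged at group level.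

Theorems only; no definition, no named fact.  Number-field / abelian-variety dress:
`AlgebraicGeometry/Pohlmann1968/SimpleDegenerateCMAbelianVarietiesCompositeDimension.lean`.

## References

* [Dodson1984] B. Dodson, Trans. AMS 283 (1984), §3.1.1, §3.2.1 (pp. 11–13).
* [Kubota1965] T. Kubota, Trans. AMS 118 (1965), §4 Lemma 2.
* [Ribet1980] K. Ribet, Mém. SMF 2 (1980), §3.
-/

set_option autoImplicit false

noncomputable section

open scoped BigOperators

namespace Literature.NumberTheory.ComplexMultiplication

namespace Dodson1984

variable {G : Type*} [CommGroup G] [Fintype G] {ρ σ : G} {n l : ℕ}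

section BlockType

variable {Φ : Finset G}

/-! ### §5 The rank: `t(Φᶠ) = n − l + 2` -/

/-- **Dodson's rank computation: `rank(Φᶠ) = n − l + 2`** for the block type on `⟨ρ⟩ × ⟨σ⟩` (`σ` of order `n`,
`l ∣ n`, `0 < l`, `2l ≠ n`) — "`r = (k − 1)l + 1` in the constant weight criterion, so `rank(K, Φᶠ) = n − l + 2`"
(by Kubota: `rank = #{odd χ} + 1 − #{odd χ vanishing on Φ} = n + 1 − (l − 1)`).
[cite: Dodson1984, §3.2.1 Theorem (proof)] -/
theorem typeRank_blockType (hρ1 : ρ ≠ 1) (hρ2 : ρ * ρ = 1) (hσ : orderOf σ = n)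
    (hρσ : ρ ∉ Subgroup.zpowers σ) (hcard : Fintype.card G = 2 * n)
    (hΦσ : ∀ i : ℕ, σ ^ i ∈ Φ ↔ l ≤ i % n) (hΦρ : ∀ i : ℕ, ρ * σ ^ i ∈ Φ ↔ i % n < l)
    (hl : 0 < l) (hln : l ∣ n) (h2l : 2 * l ≠ n) : typeRank G (Φ : Set G) = n - l + 2 := by
  classical
  have hn : 0 < n := hσ ▸ orderOf_pos σ
  have hl' : l ≤ n := Nat.le_of_dvd hn hln
  have h := (isCMTypeWith_blockType hρ2 hσ hρσ hcard hΦσ hΦρ).typeRank_add_ncard_oddCharacters_vanishing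
  rw [ncard_oddChar_vanishing_blockType hρ1 hρ2 hσ hρσ hcard hΦσ hΦρ hl hln h2l,
    ncard_oddChar hρ1 hρ2 hcard] at h
  omega

/-- **… so `Φᶠ` is DEGENERATE as soon as `l ≥ 2`**: `rank(Φᶠ) = n − l + 2 < n + 1 = |G|/2 + 1`.
[cite: Dodson1984, §3.2.1 Theorem] -/
theorem typeRank_blockType_lt (hρ1 : ρ ≠ 1) (hρ2 : ρ * ρ = 1) (hσ : orderOf σ = n)
    (hρσ : ρ ∉ Subgroup.zpowers σ) (hcard : Fintype.card G = 2 * n)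
    (hΦσ : ∀ i : ℕ, σ ^ i ∈ Φ ↔ l ≤ i % n) (hΦρ : ∀ i : ℕ, ρ * σ ^ i ∈ Φ ↔ i % n < l)
    (hl : 2 ≤ l) (hln : l ∣ n) (h2l : 2 * l ≠ n) :
    typeRank G (Φ : Set G) < Fintype.card G / 2 + 1 := by
  have hn : 0 < n := hσ ▸ orderOf_pos σ
  have hl' : l ≤ n := Nat.le_of_dvd hn hln
  rw [typeRank_blockType hρ1 hρ2 hσ hρσ hcard hΦσ hΦρ (by omega) hln h2l, hcard,
    Nat.mul_div_cancel_left _ (by norm_num : 0 < 2)]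
  omega

/-! ### §6 Primitivity: the translates of `Φᶠ` separate the points of `G` ("the orbit of `f` has order `2n`") -/

omit [Fintype G] in
/-- **No non-trivial power of `σ` stabilises `Φᶠ`** (`0 < l`, `2l < n`): if `h ∈ Φ ↔ hσᵐ ∈ Φ` for all `h` then
`σᵐ = 1` (with `j = m mod n ≠ 0`: `1 ∉ Φ` forces `j < l`, and then `σⁿ⁻ʲ ∈ Φ` while `σⁿ⁻ʲσʲ = 1 ∉ Φ`).
[cite: Dodson1984, §3.2.1 (proof)] -/
theorem pow_eq_one_of_forall_mem_iff_mul_pow (hσ : orderOf σ = n)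
    (hΦσ : ∀ i : ℕ, σ ^ i ∈ Φ ↔ l ≤ i % n) (hl : 0 < l) (h2l : 2 * l < n) {m : ℕ}
    (hm : ∀ h : G, h ∈ Φ ↔ h * σ ^ m ∈ Φ) : σ ^ m = 1 := by
  have hn : 0 < n := by omega
  set j := m % n with hj
  have hjn : j < n := Nat.mod_lt _ hn
  have hσm : σ ^ m = σ ^ j := by rw [hj, ← hσ, pow_mod_orderOf]
  by_cases hj0 : j = 0
  · rw [hσm, hj0, pow_zero]
  exfalso
  -- `1 ∉ Φ`, hence `σʲ ∉ Φ`, i.e. `j < l`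
  have h1 : (1 : G) ∉ Φ := fun h => by
    have h' := (hΦσ 0).1 (by rwa [pow_zero])
    rw [Nat.zero_mod] at h'
    omega
  have hjl : j < l := by
    have h' : σ ^ j ∉ Φ := fun h => h1 ((hm 1).2 (by rwa [one_mul, hσm]))
    rw [hΦσ, Nat.mod_eq_of_lt hjn, not_le] at h'
    exact h'
  -- `σ^(n-j) ∈ Φ` but `σ^(n-j) σ^m = σ^n... = 1 ∉ Φ`
  have h2 : σ ^ (n - j) ∈ Φ := by
    rw [hΦσ, Nat.mod_eq_of_lt (by omega)]
    omega
  have h3 : σ ^ (n - j) * σ ^ m = 1 := by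
    rw [hσm, ← pow_add, Nat.sub_add_cancel hjn.le, ← hσ, pow_orderOf_eq_one]
  exact h1 (h3 ▸ (hm _).1 h2)

omit [Fintype G] in
/-- **No element `ρσʲ` stabilises `Φᶠ`** (`0 < l`, `2l < n`): such a stabiliser would give the stabiliser
`(ρσʲ)² = σ²ʲ`, so `2j ≡ 0 (mod n)`; `j ≡ 0` contradicts the CM-type axiom at `h = 1`, and `2j = n` contradicts it at
`h = σˡ` (`σˡ ∈ Φ` but `ρσ^{l + n/2} ∉ Φ` since `l + n/2 < n`). [cite: Dodson1984, §3.2.1 (proof)] -/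
theorem not_forall_mem_iff_mul_rho_mul_pow (hρ2 : ρ * ρ = 1) (hσ : orderOf σ = n)
    (hΦσ : ∀ i : ℕ, σ ^ i ∈ Φ ↔ l ≤ i % n) (hΦρ : ∀ i : ℕ, ρ * σ ^ i ∈ Φ ↔ i % n < l)
    (hl : 0 < l) (h2l : 2 * l < n) (j : ℕ) :
    ¬ ∀ h : G, h ∈ Φ ↔ h * (ρ * σ ^ j) ∈ Φ := by
  intro hm
  have hn : 0 < n := by omega
  -- the square `σ^(2j)` stabilises, hence is trivial
  have hsq : ∀ h : G, h ∈ Φ ↔ h * σ ^ (2 * j) ∈ Φ := fun h => by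
    rw [hm h, hm (h * (ρ * σ ^ j))]
    have : h * (ρ * σ ^ j) * (ρ * σ ^ j) = h * σ ^ (2 * j) := by
      rw [two_mul, pow_add, mul_assoc, mul_mul_mul_comm, hρ2, one_mul]
    rw [this]
  have h2j : σ ^ (2 * j) = 1 := pow_eq_one_of_forall_mem_iff_mul_pow hσ hΦσ hl h2l hsq
  -- `j' = j mod n` satisfies `l ≤ j'` (from `h = 1`) and `2 j' ∈ {0, n}`
  set j' := j % n with hj'
  have hj'n : j' < n := Nat.mod_lt _ hn
  have h1 : (1 : G) ∉ Φ := fun h => by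
    have h' := (hΦσ 0).1 (by rwa [pow_zero])
    rw [Nat.zero_mod] at h'
    omega
  have hlj' : l ≤ j' := by
    have h' : ρ * σ ^ j ∉ Φ := fun h => h1 ((hm 1).2 (by rwa [one_mul]))
    rw [hΦρ, not_lt] at h'
    exact h'
  have hdvd : n ∣ 2 * j' := by
    have h := orderOf_dvd_of_pow_eq_one h2j
    rw [hσ] at h
    have hdm := Nat.div_add_mod j n
    rw [← hj'] at hdm
    have h2 : 2 * j = n * (2 * (j / n)) + 2 * j' :=
      calc 2 * j = 2 * (n * (j / n) + j') := by rw [hdm]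
        _ = n * (2 * (j / n)) + 2 * j' := by ring
    rw [h2] at h
    exact (Nat.dvd_add_right (dvd_mul_right n _)).1 h
  obtain ⟨c, hc⟩ := hdvd
  have hc2 : c < 2 := by nlinarith
  interval_cases c
  · -- `2 j' = 0`: `j' = 0 < l ≤ j'`
    omega
  · -- `2 j' = n`: test `h = σˡ ∈ Φ`, `σˡ ρσʲ = ρσ^{l+j} ∉ Φ`
    have hln : l < n := by omega
    have hσl : σ ^ l ∈ Φ := by rw [hΦσ, Nat.mod_eq_of_lt hln]
    have h3 : σ ^ l * (ρ * σ ^ j) = ρ * σ ^ (l + j) := by rw [mul_left_comm, pow_add]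
    have h4 : ρ * σ ^ (l + j) ∈ Φ := h3 ▸ (hm _).1 hσl
    rw [hΦρ, Nat.add_mod, Nat.mod_eq_of_lt hln, ← hj', Nat.mod_eq_of_lt (by omega)] at h4
    omega

/-- **The translates of `Φᶠ` separate the points of `G`** (`0 < l`, `2l < n`, i.e. `k ≥ 3`): if `gx ∈ Φ ↔ gy ∈ Φ`
for all `g` then `x = y` — the type is PRIMITIVE ("`Φ` is primitive since the orbit of `f` under `G` has order `2n`";
separation form of the tree's `isPrimitive_iff_forall_eq`). [cite: Dodson1984, §3.2.1 Theorem (proof)] -/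
theorem eq_of_forall_mul_mem_iff_blockType (hρ2 : ρ * ρ = 1) (hσ : orderOf σ = n)
    (hρσ : ρ ∉ Subgroup.zpowers σ) (hcard : Fintype.card G = 2 * n)
    (hΦσ : ∀ i : ℕ, σ ^ i ∈ Φ ↔ l ≤ i % n) (hΦρ : ∀ i : ℕ, ρ * σ ^ i ∈ Φ ↔ i % n < l)
    (hl : 0 < l) (h2l : 2 * l < n) {x y : G} (hxy : ∀ g : G, g * x ∈ Φ ↔ g * y ∈ Φ) : x = y := by
  -- `Φ` is stable under translation by `d = x⁻¹y`
  have hd : ∀ h : G, h ∈ Φ ↔ h * (x⁻¹ * y) ∈ Φ := fun h => by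
    have := hxy (h * x⁻¹)
    rwa [inv_mul_cancel_right, mul_assoc] at this
  obtain ⟨i, -, hi | hi⟩ := exists_eq_pow_or_eq_rho_mul_pow hσ hρσ hcard (x⁻¹ * y)
  · rw [hi] at hd
    have h1 := pow_eq_one_of_forall_mem_iff_mul_pow hσ hΦσ hl h2l hd
    rw [h1] at hi
    exact inv_mul_eq_one.1 hi
  · rw [hi] at hd
    exact absurd hd (not_forall_mem_iff_mul_rho_mul_pow hρ2 hσ hΦσ hΦρ hl h2l i)

end BlockType

/-! ### §7 Dodson's §3.2.1 at group level -/

/-- **Dodson 1984, §3.2.1 (A Converse of Ribet's Theorem), group-level form.**  Let `G = ⟨ρ⟩ × ⟨σ⟩` be a finite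
commutative group with `ρ` an involution `≠ 1`, `σ` of order `n = kl`, `ρ ∉ ⟨σ⟩`, `|G| = 2n`, where `k ≥ 3` and `l ≥ 2`.
Then `G` carries a CM type `Φ` (for `ρ`) which is PRIMITIVE (its translates separate the points of `G`) and
DEGENERATE of rank exactly `n − l + 2 < n + 1` — Dodson's type `Φᶠ`, `f = ((1,…,1), 0_l, …, 0_l)`.
[cite: Dodson1984, §3.2.1 Theorem] -/
theorem exists_primitive_degenerate_blockType (hρ1 : ρ ≠ 1) (hρ2 : ρ * ρ = 1) (hσ : orderOf σ = n)
    (hρσ : ρ ∉ Subgroup.zpowers σ) (hcard : Fintype.card G = 2 * n) {k : ℕ} (hk : 3 ≤ k) (hl : 2 ≤ l)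
    (hn : n = k * l) :
    ∃ Φ : Finset G, IsCMTypeWith ρ (Φ : Set G) ∧ typeRank G (Φ : Set G) = n - l + 2 ∧
      typeRank G (Φ : Set G) < Fintype.card G / 2 + 1 ∧
      ∀ x y : G, (∀ g : G, g * x ∈ Φ ↔ g * y ∈ Φ) → x = y := by
  classical
  obtain ⟨Φ, hΦσ, hΦρ⟩ := exists_blockType hσ hρσ l
  have hln : l ∣ n := ⟨k, by rw [hn, mul_comm]⟩
  have h2l : 2 * l < n := by rw [hn]; nlinarith
  exact ⟨Φ, isCMTypeWith_blockType hρ2 hσ hρσ hcard hΦσ hΦρ,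
    typeRank_blockType hρ1 hρ2 hσ hρσ hcard hΦσ hΦρ (by omega) hln h2l.ne,
    typeRank_blockType_lt hρ1 hρ2 hσ hρσ hcard hΦσ hΦρ hl hln h2l.ne,
    fun x y hxy => eq_of_forall_mul_mem_iff_blockType hρ2 hσ hρσ hcard hΦσ hΦρ (by omega) h2l hxy⟩

end Dodson1984

end Literature.NumberTheory.ComplexMultiplication

end
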